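import Summits.AtomisticToContinuum.Crystallization.Theorems.PhononSlackCertificatesPeriodicGivenLayeredRegistry2
import Literature.MathematicalPhysics.StatisticalMechanics.BarlowStackingEnergy

/-!
# Crux `PeriodicWindows` (stmt-AtomisticToContinuum-3240), line `Sketch` — stub E2m `stub_siteEnvelope`

Word-free two-sided envelopes of the SITE SHAPE SUMS of a Barlow stacking. For the inverse-power
potentials `Vₙ(r) = (r²)⁻ⁿ` (`n ≥ 3`; the crux uses `n = 3, 6`, `V_LJ = V₆/12 − V₃/6`), unit in-layer
spacing and layer spacing `c > 0`, the site energy `σₙ(m) = barlowSiteEnergy Vₙ 1 c s m` of a point of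
layer `m` of the stacking coded by a Hägg sequence `s` satisfies

`2 e₀ + (p + q) Jₙ(2) ≤ 2 σₙ(m) ≤ 2 e₀ + (p + q) Jₙ(2) + 2 ∑_{k ≥ 3} Jₙ(k)`,

with `e₀ = barlowBaseEnergy Vₙ 1 c`, `Jₙ(k) = barlowCoupling Vₙ 1 c k`, `p = 1[layers m, m+2 aligned]`,
`q = 1[layers m−2, m aligned]`; moreover `e₀ > 0` and `Jₙ(2) ≥ 0`.

Ingredients (all in the tree):
* `barlowSiteEnergy_eq` (`BarlowStackingEnergy.lean`): `σ = e₀ + ½ (∑_{k ≥ 2} J_k 1[aligned(m,m+k)] +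
  ∑_{k ≥ 2} J_k 1[aligned(m−k,m)])`, given the summability over the layer distance of the aligned and
  shifted layer sums;
* that summability for `Vₙ` (`sit_summable_layers`): each layer sum at height `k c ≠ 0` is the
  two-dimensional sum `∑ ((‖i u + j v + δ w‖² + k²c²)ⁿ)⁻¹` (`LayeredHull.reg_summable_inv_pow_layer`), bounded
  by `(∑ ((‖·‖² + c²)ⁿ⁻¹)⁻¹) · (k c)⁻²`, summable in `k`;
* ALIGNED ≥ SHIFTED (`sit_shifted_le_aligned`): by the Bernstein representation
  `∑ ((Q + H²)^{m+1})⁻¹ = (m!)⁻¹ ∫_0^∞ t^m e^{-tH²} θ_δ(t) dt` (`LayeredHull.reg_hasSum_inv_pow_integral`) and the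
  coset inequality `θ_1 ≤ θ_0` for the Gaussian layer sums (`LayeredHull.reg_theta_le_theta_zero`), every
  coupling `Jₙ(k)`, `k ≥ 1`, is `≥ 0`;
* the envelope of a masked sum `∑_{k ≥ 2} J_k 1[P k]` with `J_k ≥ 0` between its `k = 2` term and that term
  plus the full tail `∑_{k ≥ 3} J_k` (`sit_masked_tsum_bounds`).
-/

noncomputable section

namespace Summit.AtomisticToContinuum.Crystallization.Theorems.PeriodicWindowsSketch

open Literature.MathematicalPhysics.StatisticalMechanics MeasureTheory Set
open Summit.AtomisticToContinuum.Crystallization.Theorems.LayeredHull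

/-! ## The inverse-power layer sums `∑ ((‖i u + j v + δ w‖² + (k c)²)ⁿ)⁻¹` -/

/-- Pythagoras at unit spacing: `‖layerVec 1 c δ k i j‖² = ‖layerVec 1 0 δ 0 i j‖² + (k c)²`. [folklore] -/
theorem sit_norm_layerVec_sq (c : ℝ) (δ k i j : ℤ) :
    ‖layerVec 1 c δ k i j‖ ^ 2 = ‖layerVec 1 0 δ 0 i j‖ ^ 2 + ((k : ℝ) * c) ^ 2 := by
  rw [norm_layerVec, norm_layerVec, Real.sq_sqrt (by positivity), Real.sq_sqrt (by positivity)]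
  push_cast
  ring

/-- The layer interaction of `Vₙ(r) = (r²)⁻ⁿ` at unit spacing, layer spacing `c`, offset `δ` and layer
distance `k` is the inverse-power layer sum `∑_{(i,j)} ((‖i u + j v + δ w‖² + (k c)²)ⁿ)⁻¹`. [folklore] -/
theorem sit_layerInteraction_eq (n : ℕ) (c : ℝ) (δ k : ℤ) :
    layerInteraction (fun r : ℝ => (r ^ 2)⁻¹ ^ n) 1 c δ k =
      ∑' ij : ℤ × ℤ, ((‖layerVec 1 0 δ 0 ij.1 ij.2‖ ^ 2 + ((k : ℝ) * c) ^ 2) ^ n)⁻¹ := by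
  unfold layerInteraction
  refine tsum_congr fun ij => ?_
  show (‖layerVec 1 c δ k ij.1 ij.2‖ ^ 2)⁻¹ ^ n = _
  rw [inv_pow, sit_norm_layerVec_sq c δ k]

/-- The layer interactions of `Vₙ` are non-negative. [folklore] -/
theorem sit_layerInteraction_nonneg (n : ℕ) (c : ℝ) (δ k : ℤ) :
    0 ≤ layerInteraction (fun r : ℝ => (r ^ 2)⁻¹ ^ n) 1 c δ k :=
  tsum_nonneg fun _ => pow_nonneg (inv_nonneg.2 (sq_nonneg _)) n

/-- Summability of the inverse-power layer sum at a non-zero height `k c` (`n ≥ 2`, `δ ∈ {0, 1}`).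
[folklore] -/
theorem sit_summable_layer {n : ℕ} (hn : 2 ≤ n) {c : ℝ} (hc : 0 < c) (δ : ℤ) (hδ : δ = 0 ∨ δ = 1)
    {k : ℤ} (hk : k ≠ 0) :
    Summable fun ij : ℤ × ℤ => ((‖layerVec 1 0 δ 0 ij.1 ij.2‖ ^ 2 + ((k : ℝ) * c) ^ 2) ^ n)⁻¹ :=
  reg_summable_inv_pow_layer one_pos (mul_ne_zero (Int.cast_ne_zero.2 hk) hc.ne') δ hδ n hn

/-- **Decay of the layer sums in the layer distance**: for `k ≠ 0` and `m ≥ 2`,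
`layerInteraction V_{m+1} 1 c δ k ≤ (∑ ((‖·‖² + c²)^m)⁻¹) · ((k c)²)⁻¹`
(`(Q + k²c²)^{m+1} ≥ (Q + c²)^m · k²c²`). [folklore] -/
theorem sit_layerInteraction_le {m : ℕ} (hm : 2 ≤ m) {c : ℝ} (hc : 0 < c) (δ : ℤ)
    (hδ : δ = 0 ∨ δ = 1) {k : ℤ} (hk : k ≠ 0) :
    layerInteraction (fun r : ℝ => (r ^ 2)⁻¹ ^ (m + 1)) 1 c δ k ≤
      (∑' ij : ℤ × ℤ, ((‖layerVec 1 0 δ 0 ij.1 ij.2‖ ^ 2 + c ^ 2) ^ m)⁻¹) *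
        (((k : ℝ) * c) ^ 2)⁻¹ := by
  have hk1 : (1 : ℝ) ≤ |(k : ℝ)| := by exact_mod_cast Int.one_le_abs hk
  have hkc : c ^ 2 ≤ ((k : ℝ) * c) ^ 2 := by
    rw [mul_pow, ← sq_abs (k : ℝ)]
    exact le_mul_of_one_le_left (sq_nonneg c) (one_le_pow₀ hk1)
  have hkc0 : 0 < ((k : ℝ) * c) ^ 2 := lt_of_lt_of_le (by positivity) hkc
  have hS : Summable fun ij : ℤ × ℤ => ((‖layerVec 1 0 δ 0 ij.1 ij.2‖ ^ 2 + c ^ 2) ^ m)⁻¹ :=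
    reg_summable_inv_pow_layer one_pos hc.ne' δ hδ m hm
  rw [sit_layerInteraction_eq, ← hS.tsum_mul_right]
  refine Summable.tsum_le_tsum (fun ij => ?_) (sit_summable_layer (by omega) hc δ hδ hk)
    (hS.mul_right _)
  rw [← mul_inv, pow_succ _ m]
  refine inv_anti₀ (mul_pos (pow_pos (by positivity) m) hkc0) ?_
  exact mul_le_mul (pow_le_pow_left₀ (by positivity) (by linarith) m)
    (by linarith [sq_nonneg ‖layerVec 1 0 δ 0 ij.1 ij.2‖]) hkc0.le (by positivity)

/-- **Summability of the layer sums of `Vₙ` over the layer distance** (`n ≥ 3`, `δ ∈ {0, 1}`): the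
hypotheses `hA`, `hN` of `barlowSiteEnergy_eq` for the aligned (`δ = 0`) and shifted (`δ = 1`) layer
interactions. [folklore] -/
theorem sit_summable_layers {n : ℕ} (hn : 3 ≤ n) {c : ℝ} (hc : 0 < c) (δ : ℤ) (hδ : δ = 0 ∨ δ = 1) :
    Summable fun k : ℕ => layerInteraction (fun r : ℝ => (r ^ 2)⁻¹ ^ n) 1 c δ k := by
  obtain ⟨m, rfl⟩ : ∃ m, n = m + 1 := ⟨n - 1, by omega⟩
  have hm : 2 ≤ m := by omega
  have hg : Summable fun k : ℕ =>
      (∑' ij : ℤ × ℤ, ((‖layerVec 1 0 δ 0 ij.1 ij.2‖ ^ 2 + c ^ 2) ^ m)⁻¹) * (c ^ 2)⁻¹ *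
        ((k : ℝ) ^ 2)⁻¹ :=
    (Real.summable_nat_pow_inv.2 one_lt_two).mul_left _
  refine (summable_nat_add_iff (f := fun k : ℕ =>
    layerInteraction (fun r : ℝ => (r ^ 2)⁻¹ ^ (m + 1)) 1 c δ k) 1).1 (Summable.of_nonneg_of_le
    (fun k => sit_layerInteraction_nonneg _ _ _ _) (fun k => ?_) ((summable_nat_add_iff (f := fun k : ℕ =>
      (∑' ij : ℤ × ℤ, ((‖layerVec 1 0 δ 0 ij.1 ij.2‖ ^ 2 + c ^ 2) ^ m)⁻¹) * (c ^ 2)⁻¹ *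
        ((k : ℝ) ^ 2)⁻¹) 1).2 hg))
  have hk : ((k + 1 : ℕ) : ℤ) ≠ 0 := by omega
  calc layerInteraction (fun r : ℝ => (r ^ 2)⁻¹ ^ (m + 1)) 1 c δ ((k + 1 : ℕ) : ℤ)
      ≤ (∑' ij : ℤ × ℤ, ((‖layerVec 1 0 δ 0 ij.1 ij.2‖ ^ 2 + c ^ 2) ^ m)⁻¹) *
          (((((k + 1 : ℕ) : ℤ) : ℝ) * c) ^ 2)⁻¹ := sit_layerInteraction_le hm hc δ hδ hk
    _ = (∑' ij : ℤ × ℤ, ((‖layerVec 1 0 δ 0 ij.1 ij.2‖ ^ 2 + c ^ 2) ^ m)⁻¹) * (c ^ 2)⁻¹ *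
          (((k + 1 : ℕ) : ℝ) ^ 2)⁻¹ := by
        rw [Int.cast_natCast, mul_pow, mul_inv]
        ring

/-! ## Aligned ≥ shifted: the Bernstein representation -/

/-- **Bernstein representation** of the layer sums of `V_{m+1}` at a non-zero height `k c`:
`layerInteraction V_{m+1} 1 c δ k = (∫_0^∞ t^m e^{-t (kc)²} θ_δ(t) dt) / m!`, `θ_δ` the Gaussian layer sum
(`LayeredHull.reg_hasSum_inv_pow_integral`). [folklore] -/
theorem sit_layerInteraction_eq_integral {m : ℕ} (hm : 1 ≤ m) {c : ℝ} (hc : 0 < c) (δ : ℤ)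
    (hδ : δ = 0 ∨ δ = 1) {k : ℤ} (hk : k ≠ 0) :
    layerInteraction (fun r : ℝ => (r ^ 2)⁻¹ ^ (m + 1)) 1 c δ k =
      (∫ t in Ioi (0 : ℝ), t ^ m * Real.exp (-(t * ((k : ℝ) * c) ^ 2)) *
        layerInteraction (fun r => Real.exp (-t * r ^ 2)) 1 0 δ 0) / (Nat.factorial m : ℝ) := by
  have hkc : (k : ℝ) * c ≠ 0 := mul_ne_zero (Int.cast_ne_zero.2 hk) hc.ne'
  have hm0 : (Nat.factorial m : ℝ) ≠ 0 := by exact_mod_cast (Nat.factorial_pos m).ne'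
  rw [sit_layerInteraction_eq,
    ← ((reg_hasSum_inv_pow_integral one_pos hkc δ hδ m hm).div_const (Nat.factorial m : ℝ)).tsum_eq]
  refine tsum_congr fun ij => ?_
  rw [div_right_comm, div_self hm0, one_div]

/-- **ALIGNED ≥ SHIFTED**: for `k ≠ 0` and `n ≥ 3` the shifted layer sum of `Vₙ` is at most the aligned one,
`layerInteraction Vₙ 1 c 1 k ≤ layerInteraction Vₙ 1 c 0 k` (Bernstein representation, monotonicity of the
integral, and `θ_1 ≤ θ_0`, `LayeredHull.reg_theta_le_theta_zero`). [folklore] -/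
theorem sit_shifted_le_aligned {n : ℕ} (hn : 3 ≤ n) {c : ℝ} (hc : 0 < c) {k : ℤ} (hk : k ≠ 0) :
    layerInteraction (fun r : ℝ => (r ^ 2)⁻¹ ^ n) 1 c 1 k ≤
      layerInteraction (fun r : ℝ => (r ^ 2)⁻¹ ^ n) 1 c 0 k := by
  obtain ⟨m, rfl⟩ : ∃ m, n = m + 1 := ⟨n - 1, by omega⟩
  have hm : 2 ≤ m := by omega
  have hkc : (k : ℝ) * c ≠ 0 := mul_ne_zero (Int.cast_ne_zero.2 hk) hc.ne'
  have hkc2 : 0 < ((k : ℝ) * c) ^ 2 := by positivity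
  rw [sit_layerInteraction_eq_integral (by omega) hc 1 (Or.inr rfl) hk,
    sit_layerInteraction_eq_integral (by omega) hc 0 (Or.inl rfl) hk]
  refine div_le_div_of_nonneg_right ?_ (Nat.cast_nonneg _)
  refine setIntegral_mono_on (reg_integrableOn_theta_mul one_ne_zero 1 hkc2 m hm)
    (reg_integrableOn_theta_mul one_ne_zero 0 hkc2 m hm) measurableSet_Ioi fun t ht => ?_
  have ht' : (0 : ℝ) < t := ht
  exact mul_le_mul_of_nonneg_left (reg_theta_le_theta_zero one_ne_zero 1 ht') (by positivity)

/-- **Non-negativity of the couplings**: `Jₙ(k) = barlowCoupling Vₙ 1 c k ≥ 0` for `k ≥ 1`, `n ≥ 3`.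
[folklore] -/
theorem sit_barlowCoupling_nonneg {n : ℕ} (hn : 3 ≤ n) {c : ℝ} (hc : 0 < c) {k : ℕ} (hk : k ≠ 0) :
    0 ≤ barlowCoupling (fun r : ℝ => (r ^ 2)⁻¹ ^ n) 1 c k := by
  unfold barlowCoupling
  exact sub_nonneg.2 (sit_shifted_le_aligned hn hc (by exact_mod_cast hk))

/-! ## Positivity of the base energy -/

/-- The shifted layer sum of `Vₙ` at height `c` is positive (`n ≥ 2`). [folklore] -/
theorem sit_layerInteraction_pos {n : ℕ} (hn : 2 ≤ n) {c : ℝ} (hc : 0 < c) :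
    0 < layerInteraction (fun r : ℝ => (r ^ 2)⁻¹ ^ n) 1 c 1 1 := by
  rw [sit_layerInteraction_eq]
  exact (sit_summable_layer hn hc 1 (Or.inr rfl) one_ne_zero).tsum_pos (fun ij => by positivity)
    (0, 0) (by positivity)

/-- **Positivity of the base energy** `e₀ = ½ Φ₀ + ∑_{k ≥ 1} Φ_N(k)` of `Vₙ` (`n ≥ 3`): `Φ₀ ≥ 0` termwise and
`∑_{k ≥ 1} Φ_N(k) ≥ Φ_N(1) > 0`. [folklore] -/
theorem sit_barlowBaseEnergy_pos {n : ℕ} (hn : 3 ≤ n) {c : ℝ} (hc : 0 < c) :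
    0 < barlowBaseEnergy (fun r : ℝ => (r ^ 2)⁻¹ ^ n) 1 c := by
  have h0 : 0 ≤ inLayerInteraction (fun r : ℝ => (r ^ 2)⁻¹ ^ n) 1 :=
    tsum_nonneg fun ij => by
      split_ifs
      · exact le_rfl
      · exact pow_nonneg (inv_nonneg.2 (sq_nonneg _)) n
  have hN1 : Summable fun k : ℕ =>
      layerInteraction (fun r : ℝ => (r ^ 2)⁻¹ ^ n) 1 c 1 ((k + 1 : ℕ) : ℤ) :=
    (summable_nat_add_iff (f := fun k : ℕ =>
      layerInteraction (fun r : ℝ => (r ^ 2)⁻¹ ^ n) 1 c 1 k) 1).2 (sit_summable_layers hn hc 1 (Or.inr rfl))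
  have h1 := hN1.le_tsum 0 fun j _ => sit_layerInteraction_nonneg _ _ _ _
  have h2 : 0 < layerInteraction (fun r : ℝ => (r ^ 2)⁻¹ ^ n) 1 c 1 ((0 + 1 : ℕ) : ℤ) := by
    simpa using sit_layerInteraction_pos (by omega : 2 ≤ n) hc
  unfold barlowBaseEnergy
  linarith

/-! ## The envelope of a masked coupling sum -/

/-- **Envelope of a masked coupling sum.** For summable `J` with `J k ≥ 0` for `k ≥ 2` and any predicate
`P`: `1[P 2] J 2 ≤ ∑'_{k ≥ 2, P k} J k ≤ 1[P 2] J 2 + ∑_{k ≥ 3} J k` (split off `k < 3`, compare the tails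
termwise). [folklore] -/
theorem sit_masked_tsum_bounds {J : ℕ → ℝ} (hJ : Summable J) (hJ0 : ∀ k, 2 ≤ k → 0 ≤ J k)
    (P : ℕ → Prop) [DecidablePred P] :
    (if P 2 then (1 : ℝ) else 0) * J 2 ≤ (∑' k : ℕ, if 2 ≤ k ∧ P k then J k else 0) ∧
      (∑' k : ℕ, if 2 ≤ k ∧ P k then J k else 0) ≤
        (if P 2 then (1 : ℝ) else 0) * J 2 + ∑' k : ℕ, J (k + 3) := by
  have hFs : Summable fun k => if 2 ≤ k ∧ P k then J k else 0 := summable_ite_of_summable hJ _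
  have hF0 : ∀ k, 0 ≤ (if 2 ≤ k ∧ P k then J k else 0) := fun k => by
    split_ifs with h
    · exact hJ0 k h.1
    · exact le_rfl
  have hFle : ∀ k, (if 2 ≤ k + 3 ∧ P (k + 3) then J (k + 3) else 0) ≤ J (k + 3) := fun k => by
    split_ifs with h
    · exact le_rfl
    · exact hJ0 _ (by omega)
  have hsplit := (hFs.sum_add_tsum_nat_add 3).symm
  have h3 : ∑ i ∈ Finset.range 3, (if 2 ≤ i ∧ P i then J i else 0) =
      (if P 2 then (1 : ℝ) else 0) * J 2 := by
    rw [Finset.sum_range_succ, Finset.sum_range_succ, Finset.sum_range_one]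
    have h0 : ¬ (2 ≤ 0 ∧ P 0) := fun h => absurd h.1 (by norm_num)
    have h1 : ¬ (2 ≤ 1 ∧ P 1) := fun h => absurd h.1 (by norm_num)
    rw [if_neg h0, if_neg h1, zero_add, zero_add]
    by_cases hP : P 2
    · rw [if_pos ⟨le_rfl, hP⟩, if_pos hP, one_mul]
    · rw [if_neg (fun h => hP h.2), if_neg hP, zero_mul]
  have hJ3 : Summable fun k => J (k + 3) := (summable_nat_add_iff (f := J) 3).2 hJ
  have hF3 : Summable fun k => if 2 ≤ k + 3 ∧ P (k + 3) then J (k + 3) else 0 :=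
    (summable_nat_add_iff (f := fun k => if 2 ≤ k ∧ P k then J k else 0) 3).2 hFs
  have htail0 : 0 ≤ ∑' k, (if 2 ≤ k + 3 ∧ P (k + 3) then J (k + 3) else 0) :=
    tsum_nonneg fun k => hF0 (k + 3)
  have htail1 : ∑' k, (if 2 ≤ k + 3 ∧ P (k + 3) then J (k + 3) else 0) ≤ ∑' k, J (k + 3) :=
    Summable.tsum_le_tsum hFle hF3 hJ3
  constructor <;> linarith

/-! ## The site envelope -/

/-- **The site envelope for a general potential.** If the aligned and shifted layer interactions of `V` are
summable over the layer distance and the couplings `J_k = barlowCoupling V a h k`, `k ≥ 2`, are `≥ 0`, then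
for every Hägg sequence `s` and layer `m`, with `p = 1[aligned(m, m+2)]`, `q = 1[aligned(m−2, m)]`:
`2 e₀ + (p + q) J 2 ≤ 2 σ(m) ≤ 2 e₀ + (p + q) J 2 + 2 ∑_{k ≥ 3} J k` (`barlowSiteEnergy_eq` and
`sit_masked_tsum_bounds` for the forward and backward local energies). [folklore] -/
theorem sit_site_bounds (V : ℝ → ℝ) (a h : ℝ) {s : ℤ → ℤ} (hs : IsHaggSeq s)
    (hA : Summable fun k : ℕ => layerInteraction V a h 0 k)
    (hN : Summable fun k : ℕ => layerInteraction V a h 1 k)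
    (hJ0 : ∀ k : ℕ, 2 ≤ k → 0 ≤ barlowCoupling V a h k) (m : ℤ) :
    (2 * barlowBaseEnergy V a h +
        ((if HaggAligned s m 2 then (1 : ℝ) else 0) +
            (if HaggAligned s (m - (2 : ℕ)) 2 then (1 : ℝ) else 0)) * barlowCoupling V a h 2 ≤
      2 * barlowSiteEnergy V a h s m) ∧
    2 * barlowSiteEnergy V a h s m ≤ 2 * barlowBaseEnergy V a h +
        ((if HaggAligned s m 2 then (1 : ℝ) else 0) +
            (if HaggAligned s (m - (2 : ℕ)) 2 then (1 : ℝ) else 0)) * barlowCoupling V a h 2 +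
      2 * ∑' k : ℕ, barlowCoupling V a h (k + 3) := by
  have hJ : Summable fun k : ℕ => barlowCoupling V a h k := hA.sub hN
  -- `2 σ = 2 e₀ + (forward + backward local energies)` (no `1/2` left for `linarith`)
  have key : 2 * barlowSiteEnergy V a h s m = 2 * barlowBaseEnergy V a h +
      (haggLocalEnergy (barlowCoupling V a h) s m +
        haggBackwardLocalEnergy (barlowCoupling V a h) s m) := by
    rw [barlowSiteEnergy_eq V a h hs hA hN m]
    ring
  obtain ⟨hL1, hL2⟩ := sit_masked_tsum_bounds hJ hJ0 (HaggAligned s m)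
  obtain ⟨hB1, hB2⟩ := sit_masked_tsum_bounds hJ hJ0 (fun k : ℕ => HaggAligned s (m - k) k)
  rw [key, haggLocalEnergy, haggBackwardLocalEnergy]
  constructor <;> linarith

/-- **STUB E2m `stub_siteEnvelope` (WORD-FREE SITE ENVELOPES)**: for a Hägg sequence `s`, a shape `c > 0`
and a layer `m`, with `p = 1[layers m, m+2 aligned]`, `q = 1[layers m−2, m aligned]` (the same for `n = 3`
and `6`): `2 e₀(n,c) + (p+q) Jₙ(c,2) ≤ 2 σₙ(m) ≤ 2 e₀(n,c) + (p+q) Jₙ(c,2) + 2 ∑_{k ≥ 3} Jₙ(c,k)`, and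
`e₀(n,c) > 0`, `Jₙ(c,2) ≥ 0`. [folklore] -/
theorem stub_siteEnvelope (c : ℝ) (hc : 0 < c) (s : ℤ → ℤ) (hs : IsHaggSeq s) (m : ℤ) :
    ∃ p q : ℝ, (p = 0 ∨ p = 1) ∧ (q = 0 ∨ q = 1) ∧
      (2 * barlowBaseEnergy (fun r => (r ^ 2)⁻¹ ^ 3) 1 c + (p + q) * barlowCoupling (fun r => (r ^ 2)⁻¹ ^ 3) 1 c 2
          ≤ 2 * barlowSiteEnergy (fun r => (r ^ 2)⁻¹ ^ 3) 1 c s m ∧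
        2 * barlowSiteEnergy (fun r => (r ^ 2)⁻¹ ^ 3) 1 c s m ≤
          2 * barlowBaseEnergy (fun r => (r ^ 2)⁻¹ ^ 3) 1 c + (p + q) * barlowCoupling (fun r => (r ^ 2)⁻¹ ^ 3) 1 c 2 +
            2 * ∑' k : ℕ, barlowCoupling (fun r => (r ^ 2)⁻¹ ^ 3) 1 c (k + 3)) ∧
      (2 * barlowBaseEnergy (fun r => (r ^ 2)⁻¹ ^ 6) 1 c + (p + q) * barlowCoupling (fun r => (r ^ 2)⁻¹ ^ 6) 1 c 2
          ≤ 2 * barlowSiteEnergy (fun r => (r ^ 2)⁻¹ ^ 6) 1 c s m ∧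
        2 * barlowSiteEnergy (fun r => (r ^ 2)⁻¹ ^ 6) 1 c s m ≤
          2 * barlowBaseEnergy (fun r => (r ^ 2)⁻¹ ^ 6) 1 c + (p + q) * barlowCoupling (fun r => (r ^ 2)⁻¹ ^ 6) 1 c 2 +
            2 * ∑' k : ℕ, barlowCoupling (fun r => (r ^ 2)⁻¹ ^ 6) 1 c (k + 3)) ∧
      0 < barlowBaseEnergy (fun r => (r ^ 2)⁻¹ ^ 3) 1 c ∧ 0 < barlowBaseEnergy (fun r => (r ^ 2)⁻¹ ^ 6) 1 c ∧
      0 ≤ barlowCoupling (fun r => (r ^ 2)⁻¹ ^ 3) 1 c 2 ∧ 0 ≤ barlowCoupling (fun r => (r ^ 2)⁻¹ ^ 6) 1 c 2 := by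
  have h3 : (3 : ℕ) ≤ 3 := le_rfl
  have h6 : (3 : ℕ) ≤ 6 := by norm_num
  refine ⟨if HaggAligned s m 2 then 1 else 0, if HaggAligned s (m - (2 : ℕ)) 2 then 1 else 0,
    by split_ifs <;> simp, by split_ifs <;> simp,
    sit_site_bounds (fun r => (r ^ 2)⁻¹ ^ 3) 1 c hs (sit_summable_layers h3 hc 0 (Or.inl rfl))
      (sit_summable_layers h3 hc 1 (Or.inr rfl)) (fun k hk => sit_barlowCoupling_nonneg h3 hc (by omega)) m,
    sit_site_bounds (fun r => (r ^ 2)⁻¹ ^ 6) 1 c hs (sit_summable_layers h6 hc 0 (Or.inl rfl))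
      (sit_summable_layers h6 hc 1 (Or.inr rfl)) (fun k hk => sit_barlowCoupling_nonneg h6 hc (by omega)) m,
    sit_barlowBaseEnergy_pos h3 hc, sit_barlowBaseEnergy_pos h6 hc,
    sit_barlowCoupling_nonneg h3 hc two_ne_zero, sit_barlowCoupling_nonneg h6 hc two_ne_zero⟩

end Summit.AtomisticToContinuum.Crystallization.Theorems.PeriodicWindowsSketch
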